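import Summits.NavierStokesRegularity.NavierStokesRegularity.Theorems.LevelSetModerationHighSpeedPressureWorkWeakMaxPrinciple
import Summits.NavierStokesRegularity.NavierStokesRegularity.Theorems.IsobarTomographyBlobRiccatiClosureStubPressureLaplacian
import Literature.Analysis.FluidPDE.ClassicalSolutionCalculus

/-!
# Route LevelSetModeration — `HighSpeedPressureWork`: the comoving head ceiling

Support file for item stmt-NavierStokesRegularity-18149; proves the registered stub `stub_headCeiling`
of line `Sketch`. For a classical solution `(u, p)` of the unforced Navier–Stokes system on
`ℝ³ × [0,T)` (`ν > 0`), a Galilean frame `U`, a head level `K` with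
`H_U(0) := p(0) + |u(0) - U|²/2 ≤ K`, a continuous rate `r` dominating the comoving pressure tendency
`∂ₜp + Dp(U) ≤ r(τ)` on `[0,t] × ℝ³` (`t < T`), and bounded `u`, `H_U` on `[0,t] × ℝ³`:

  `H_U(τ, x) ≤ K + ∫₀^τ r`   on `[0,t] × ℝ³`.

The comoving Bernoulli head is a SUBSOLUTION of the drift–heat operator:
`(∂ₜ + u·∇ − νΔ) H_U = ∂ₜp + Dp(U) − ν‖curl u‖² ≤ ∂ₜp + Dp(U)` (momentum equation dotted with
`u − U`, pressure Poisson equation `Δp = ‖curl u‖² − |Du|²_F`, `stub_pressureLaplacian`), so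
`w = H_U − K − ∫₀^τ r` satisfies `wₜ + Dw(u) − νΔw ≤ 0`, `w(0) ≤ 0`, `w` bounded above, and the
weak maximum principle `levelSetModeration_weakMaxPrinciple` gives `w ≤ 0`.
(NRŠ 1996, Lemma 3.3 and the Remark after it; Gilbarg–Weinberger; here in the Galilean frame `U`.)
-/

noncomputable section

-- single-conjunct summit: `Summit.<Summit>.<Problem>` repeats the name by the D-0017 layout
set_option linter.dupNamespace false

namespace Summit.NavierStokesRegularity.NavierStokesRegularity.Theorems

open Set Filter Topology Function Metric MeasureTheory
open scoped RealInnerProductSpace Laplacian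
open Literature.Analysis.FluidPDE

section Head

variable {ν T : ℝ} {u : ℝ → EuclideanSpace ℝ (Fin 3) → EuclideanSpace ℝ (Fin 3)}
  {p : ℝ → EuclideanSpace ℝ (Fin 3) → ℝ}

/-- **Spatial derivatives of the comoving head** `H(y) = p(y) + ‖v(y) - U‖²/2` for `C²` data:
`DH(x)(e) = Dp(x)(e) + ⟨v x - U, Dv(x)(e)⟩` and `ΔH(x) = Δp(x) + ⟨Δv(x), v x - U⟩ + |Dv(x)|²_F`.
[folklore] -/
theorem levelSetModeration_head_space_derivatives {v : EuclideanSpace ℝ (Fin 3) → EuclideanSpace ℝ (Fin 3)}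
    {q : EuclideanSpace ℝ (Fin 3) → ℝ} (hv : ContDiff ℝ 2 v) (hq : ContDiff ℝ 2 q)
    (U x e : EuclideanSpace ℝ (Fin 3)) :
    ContDiff ℝ 2 (fun y => q y + ‖v y - U‖ ^ 2 / 2) ∧
    fderiv ℝ (fun y => q y + ‖v y - U‖ ^ 2 / 2) x e = fderiv ℝ q x e + ⟪v x - U, fderiv ℝ v x e⟫ ∧
    (Δ (fun y => (q y + ‖v y - U‖ ^ 2 / 2 : ℝ))) x =
      (Δ q) x + ⟪(Δ v) x, v x - U⟫ + frobeniusNormSq (fderiv ℝ v x) := by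
  set V : EuclideanSpace ℝ (Fin 3) → EuclideanSpace ℝ (Fin 3) := fun y => v y - U with hV
  have hVC2 : ContDiff ℝ 2 V := hv.sub contDiff_const
  have hsq : (fun y => ‖v y - U‖ ^ 2 / 2) = fun y => (2 : ℝ)⁻¹ * ⟪V y, V y⟫ := by
    funext y; rw [real_inner_self_eq_norm_sq]; ring
  have hsqC2 : ContDiff ℝ 2 fun y => ‖v y - U‖ ^ 2 / 2 := by
    rw [hsq]; exact contDiff_const.mul (hVC2.inner ℝ hVC2)
  refine ⟨hq.add hsqC2, ?_, ?_⟩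
  · -- first derivative
    have hqd : DifferentiableAt ℝ q x := (hq.differentiable two_ne_zero) x
    have hvd : DifferentiableAt ℝ v x := (hv.differentiable two_ne_zero) x
    have hVd : HasFDerivAt V (fderiv ℝ v x) x := by
      have := hvd.hasFDerivAt.sub_const U
      exact this
    have hn := hVd.norm_sq
    have hsqd : HasFDerivAt (fun y => ‖v y - U‖ ^ 2 / 2)
        ((2 : ℝ)⁻¹ • ((2 : ℕ) • (innerSL ℝ (V x)).comp (fderiv ℝ v x))) x := by
      have h2 := hn.const_mul (2 : ℝ)⁻¹
      have hfun : (fun y => ‖v y - U‖ ^ 2 / 2) = fun y => (2 : ℝ)⁻¹ * ‖V y‖ ^ 2 := by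
        funext y; show ‖v y - U‖ ^ 2 / 2 = 2⁻¹ * ‖v y - U‖ ^ 2; ring
      rw [hfun]
      convert h2 using 1
    rw [fderiv_fun_add hqd hsqd.differentiableAt, hsqd.fderiv]
    rw [add_apply, smul_apply, smul_apply, ContinuousLinearMap.comp_apply, innerSL_apply_apply,
      nsmul_eq_mul, smul_eq_mul]
    show fderiv ℝ q x e + 2⁻¹ * ((2 : ℕ) * ⟪v x - U, fderiv ℝ v x e⟫) = _
    push_cast
    ring
  · -- Laplacian
    rw [show (fun y => (q y + ‖v y - U‖ ^ 2 / 2 : ℝ)) = q + fun y => ‖v y - U‖ ^ 2 / 2 from rfl]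
    rw [ContDiffAt.laplacian_add hq.contDiffAt hsqC2.contDiffAt, hsq]
    have hsm : (fun y => (2 : ℝ)⁻¹ * ⟪V y, V y⟫) = (2 : ℝ)⁻¹ • fun y => ⟪V y, V y⟫ := by
      funext y; simp [smul_eq_mul]
    rw [hsm, InnerProductSpace.laplacian_smul _ (hVC2.inner ℝ hVC2).contDiffAt, smul_eq_mul,
      laplacian_inner_self_eq hVC2 x]
    have hΔV : (Δ V) x = (Δ v) x := by
      rw [show V = v + fun _ => -U from by funext y; simp [hV, sub_eq_add_neg]]
      rw [ContDiffAt.laplacian_add hv.contDiffAt contDiff_const.contDiffAt]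
      simp [InnerProductSpace.laplacian_const]
    have hDV : fderiv ℝ V x = fderiv ℝ v x := fderiv_sub_const U
    rw [hΔV, hDV]
    ring

/-- **The comoving head is a subsolution of the drift–heat operator.** For a classical solution of
the unforced Navier–Stokes system on `ℝ³ × [0,T)`, a frame `U` and an interior time `τ ∈ (0,T)`:
with `H(τ,x) = p(τ,x) + ‖u(τ,x) - U‖²/2`,
`Hₜ + DH(u) − νΔH = ∂ₜp + Dp(U) − ν‖curl u‖²`, hence `≤ ∂ₜp + Dp(U)` for `ν ≥ 0`, where
`Hₜ = ∂ₜp + ⟨u − U, ∂ₜu⟩` (momentum equation and the pressure Poisson equation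
`Δp = ‖curl u‖² − |Du|²_F`, `stub_pressureLaplacian`). [cite: NecasRuzickaSverak1996, Lemma 3.3] -/
theorem levelSetModeration_head_subsolution (hν : 0 ≤ ν)
    (hcl : IsClassicalNSSolutionOn (Ico 0 T) ν 0 u p) (U : EuclideanSpace ℝ (Fin 3))
    {τ : ℝ} (hτ : τ ∈ Ioo 0 T) (x : EuclideanSpace ℝ (Fin 3)) :
    (timeDerivWithin (Ico 0 T) p τ x + ⟪u τ x - U, timeDerivWithin (Ico 0 T) u τ x⟫) +
        fderiv ℝ (fun y => p τ y + ‖u τ y - U‖ ^ 2 / 2) x (u τ x) -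
        ν * (Δ (fun y => (p τ y + ‖u τ y - U‖ ^ 2 / 2 : ℝ))) x ≤
      timeDerivWithin (Ico 0 T) p τ x + fderiv ℝ (p τ) x U := by
  have hτ' : τ ∈ Ico 0 T := ⟨hτ.1.le, hτ.2⟩
  have hu2 : ContDiff ℝ 2 (u τ) := (hcl.contDiff_velocity hτ').of_le (by norm_cast)
  have hp2 : ContDiff ℝ 2 (p τ) := (hcl.contDiff_pressure hτ').of_le (by norm_cast)
  obtain ⟨-, hD, hΔ⟩ := levelSetModeration_head_space_derivatives hu2 hp2 U x (u τ x)
  rw [hD, hΔ]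
  -- the momentum equation at `(τ, x)` dotted with `u − U`
  have hmom := hcl.momentum τ hτ' x
  simp only [Pi.zero_apply, add_zero, convect_apply] at hmom
  have hdot : ⟪u τ x - U, timeDerivWithin (Ico 0 T) u τ x⟫ + ⟪u τ x - U, fderiv ℝ (u τ) x (u τ x)⟫ -
      ν * ⟪(Δ (u τ)) x, u τ x - U⟫ = -(fderiv ℝ (p τ) x (u τ x) - fderiv ℝ (p τ) x U) := by
    have h1 : timeDerivWithin (Ico 0 T) u τ x + fderiv ℝ (u τ) x (u τ x) - ν • (Δ (u τ)) x =
        -gradient (p τ) x := by rw [hmom]; abel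
    have h2 := congrArg (fun z => ⟪u τ x - U, z⟫) h1
    simp only [inner_add_right, inner_sub_right, inner_smul_right, inner_neg_right] at h2
    have h3 : ⟪u τ x - U, (Δ (u τ)) x⟫ = ⟪(Δ (u τ)) x, u τ x - U⟫ := real_inner_comm _ _
    rw [← h3, h2, ← real_inner_comm (u τ x - U) (gradient (p τ) x), inner_gradient_left, map_sub]
  -- the pressure Poisson equation
  have hP := BlobRiccatiClosure.Sketch.stub_pressureLaplacian ν T u p hcl τ hτ x
  have hcurl : 0 ≤ ν * ‖curl (u τ) x‖ ^ 2 := by positivity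
  nlinarith [hdot, hP, hcurl]

/-- **The comoving head ceiling** (registered stub `stub_headCeiling` of the crux item
stmt-NavierStokesRegularity-18149, line `Sketch`): see the module docstring.
[cite: NecasRuzickaSverak1996, Lemma 3.3] -/
theorem stub_headCeiling :
    ∀ (ν T : ℝ) (u : ℝ → EuclideanSpace ℝ (Fin 3) → EuclideanSpace ℝ (Fin 3)) (p : ℝ → EuclideanSpace ℝ (Fin 3) → ℝ), 0 < ν → 0 < T → Literature.Analysis.FluidPDE.IsClassicalNSSolutionOn (Set.Ico 0 T) ν 0 u p → Literature.Analysis.FluidPDE.IsLerayHopfOn T ν 0 (u 0) u → Literature.Analysis.FluidPDE.HasRapidSpatialDecay (u 0) → ∀ (U : EuclideanSpace ℝ (Fin 3)) (K : ℝ) (r : ℝ → ℝ) (t : ℝ), t ∈ Set.Ico 0 T → Continuous r → (∀ x, p 0 x + ‖u 0 x - U‖ ^ 2 / 2 ≤ K) → (∀ τ ∈ Set.Icc 0 t, ∀ x, Literature.Analysis.FluidPDE.timeDerivWithin (Set.Ico 0 T) p τ x + fderiv ℝ (p τ) x U ≤ r τ) → (∃ B : ℝ, ∀ τ ∈ Set.Icc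 0 t, ∀ x, ‖u τ x‖ ≤ B ∧ p τ x + ‖u τ x - U‖ ^ 2 / 2 ≤ B) → ∀ τ ∈ Set.Icc 0 t, ∀ x, p τ x + ‖u τ x - U‖ ^ 2 / 2 ≤ K + ∫ σ in Set.Ioo 0 τ, r σ := by
  intro ν T u p hν _hT hcl _hLH _hdec U K r t ht hr hK htend hbds τ hτ x
  -- the primitive of `r`
  set Ir : ℝ → ℝ := fun s => ∫ σ in (0 : ℝ)..s, r σ with hIrdef
  have hIr_cont : Continuous Ir :=
    intervalIntegral.continuous_primitive (fun a b => hr.intervalIntegrable a b) 0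
  have hIr_deriv : ∀ s, HasDerivAt Ir (r s) s := fun s =>
    (hr.integral_hasStrictDerivAt 0 s).hasDerivAt
  have hIr_eq : ∀ s, 0 ≤ s → (∫ σ in Ioo 0 s, r σ) = Ir s := by
    intro s hs
    show (∫ σ in Ioo 0 s, r σ) = ∫ σ in (0 : ℝ)..s, r σ
    rw [intervalIntegral.integral_of_le hs, integral_Ioc_eq_integral_Ioo]
  have hIr0 : Ir 0 = 0 := by show (∫ σ in (0 : ℝ)..0, r σ) = 0; exact intervalIntegral.integral_same
  rw [hIr_eq τ hτ.1]
  -- the case `τ = 0`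
  rcases eq_or_lt_of_le hτ.1 with h0 | hτpos
  · rw [← h0, hIr0, add_zero]; exact hK x
  have htpos : 0 < t := hτpos.trans_le hτ.2
  -- bounds
  obtain ⟨B, hB⟩ := hbds
  have hB0 : 0 ≤ B := (norm_nonneg _).trans (hB 0 ⟨le_rfl, ht.1⟩ 0).1
  obtain ⟨R, hR⟩ := isCompact_Icc.exists_bound_of_continuousOn (s := Icc 0 t) hr.continuousOn
  have hR0 : 0 ≤ R := (norm_nonneg _).trans (hR 0 ⟨le_rfl, ht.1⟩)
  have hIr_bd : ∀ s ∈ Icc 0 t, |Ir s| ≤ R * t := by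
    intro s hs
    have h1 : ‖∫ σ in (0 : ℝ)..s, r σ‖ ≤ R * |s - 0| :=
      intervalIntegral.norm_integral_le_of_norm_le_const fun σ hσ => by
        rw [uIoc_of_le hs.1] at hσ
        exact hR σ ⟨hσ.1.le, hσ.2.trans hs.2⟩
    rw [Real.norm_eq_abs, sub_zero, abs_of_nonneg hs.1] at h1
    exact h1.trans (mul_le_mul_of_nonneg_left hs.2 hR0)
  -- the subsolution `w = H − K − Ir`
  set w : ℝ → EuclideanSpace ℝ (Fin 3) → ℝ :=
    fun s y => p s y + ‖u s y - U‖ ^ 2 / 2 - K - Ir s with hw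
  set wt : ℝ → EuclideanSpace ℝ (Fin 3) → ℝ := fun s y =>
    timeDerivWithin (Ico 0 T) p s y + ⟪u s y - U, timeDerivWithin (Ico 0 T) u s y⟫ - r s with hwt
  have hU : UniqueDiffOn ℝ (Ico 0 T) := uniqueDiffOn_Ico 0 T
  have hu := hcl.smooth_velocity
  have hp := hcl.smooth_pressure
  -- hypotheses of the weak maximum principle
  have hcont : ContinuousOn (uncurry w) (Icc 0 t ×ˢ univ) := by
    have hsub : Icc 0 t ×ˢ (univ : Set (EuclideanSpace ℝ (Fin 3))) ⊆ Ico 0 T ×ˢ univ :=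
      prod_mono (fun s hs => ⟨hs.1, hs.2.trans_lt ht.2⟩) Subset.rfl
    have h1 : ContinuousOn (uncurry p) (Icc 0 t ×ˢ univ) := hp.continuousOn.mono hsub
    have h2 : ContinuousOn (uncurry u) (Icc 0 t ×ˢ univ) := hu.continuousOn.mono hsub
    have h3 : ContinuousOn (fun z : ℝ × EuclideanSpace ℝ (Fin 3) => Ir z.1) (Icc 0 t ×ˢ univ) :=
      (hIr_cont.comp continuous_fst).continuousOn
    show ContinuousOn (fun z : ℝ × EuclideanSpace ℝ (Fin 3) =>
      p z.1 z.2 + ‖u z.1 z.2 - U‖ ^ 2 / 2 - K - Ir z.1) (Icc 0 t ×ˢ univ)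
    exact ((h1.add (((h2.sub continuousOn_const).norm.pow 2).div_const _)).sub continuousOn_const).sub h3
  have hC2 : ∀ s ∈ Ioc 0 t, ContDiff ℝ 2 (w s) := by
    intro s hs
    have hs' : s ∈ Ico 0 T := ⟨hs.1.le, hs.2.trans_lt ht.2⟩
    have hu2 : ContDiff ℝ 2 (u s) := (hcl.contDiff_velocity hs').of_le (by norm_cast)
    have hp2 : ContDiff ℝ 2 (p s) := (hcl.contDiff_pressure hs').of_le (by norm_cast)
    obtain ⟨hH, -, -⟩ := levelSetModeration_head_space_derivatives hu2 hp2 U 0 0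
    show ContDiff ℝ 2 fun y => p s y + ‖u s y - U‖ ^ 2 / 2 - K - Ir s
    exact (hH.sub contDiff_const).sub contDiff_const
  have htime : ∀ s ∈ Ioc 0 t, ∀ y, HasDerivWithinAt (fun σ => w σ y) (wt s y) (Ico 0 T) s := by
    intro s hs y
    have hs' : s ∈ Ico 0 T := ⟨hs.1.le, hs.2.trans_lt ht.2⟩
    have hpd := hp.hasDerivWithinAt_timeDerivWithin hU hs' y
    have hud := hu.hasDerivWithinAt_timeDerivWithin hU hs' y
    have hVd : HasDerivWithinAt (fun σ => u σ y - U) (timeDerivWithin (Ico 0 T) u s y) (Ico 0 T) s :=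
      hud.sub_const U
    have hsq := hVd.norm_sq
    have hsq2 : HasDerivWithinAt (fun σ => ‖u σ y - U‖ ^ 2 / 2)
        (⟪u s y - U, timeDerivWithin (Ico 0 T) u s y⟫) (Ico 0 T) s :=
      (hsq.div_const 2).congr_deriv (by ring)
    have hIrd : HasDerivWithinAt Ir (r s) (Ico 0 T) s := (hIr_deriv s).hasDerivWithinAt
    have hall := ((hpd.add hsq2).sub_const K).sub hIrd
    show HasDerivWithinAt (fun σ => p σ y + ‖u σ y - U‖ ^ 2 / 2 - K - Ir σ)
      (timeDerivWithin (Ico 0 T) p s y + ⟪u s y - U, timeDerivWithin (Ico 0 T) u s y⟫ - r s) (Ico 0 T) s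
    exact hall
  have ha : ∀ s ∈ Ioc 0 t, ∀ y, ‖u s y‖ ≤ B := fun s hs y => (hB s ⟨hs.1.le, hs.2⟩ y).1
  have hsubsol : ∀ s ∈ Ioc 0 t, ∀ y,
      wt s y + fderiv ℝ (w s) y (u s y) - ν * (Δ (w s)) y ≤ 0 := by
    intro s hs y
    have hs' : s ∈ Ioo 0 T := ⟨hs.1, hs.2.trans_lt ht.2⟩
    have hsIco : s ∈ Ico 0 T := ⟨hs.1.le, hs'.2⟩
    have hu2 : ContDiff ℝ 2 (u s) := (hcl.contDiff_velocity hsIco).of_le (by norm_cast)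
    have hp2 : ContDiff ℝ 2 (p s) := (hcl.contDiff_pressure hsIco).of_le (by norm_cast)
    obtain ⟨hH, -, -⟩ := levelSetModeration_head_space_derivatives hu2 hp2 U y (u s y)
    -- spatial derivatives of `w s` are those of the head (constants drop out)
    have hwfun : w s = fun z => (p s z + ‖u s z - U‖ ^ 2 / 2) + (-K - Ir s) := by
      funext z; show p s z + ‖u s z - U‖ ^ 2 / 2 - K - Ir s = _; ring
    have hDw : fderiv ℝ (w s) y (u s y) =
        fderiv ℝ (fun z => p s z + ‖u s z - U‖ ^ 2 / 2) y (u s y) := by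
      rw [hwfun, fderiv_add_const]
    have hΔw : (Δ (w s)) y = (Δ (fun z => (p s z + ‖u s z - U‖ ^ 2 / 2 : ℝ))) y := by
      rw [hwfun, show (fun z => p s z + ‖u s z - U‖ ^ 2 / 2 + (-K - Ir s)) =
        (fun z => (p s z + ‖u s z - U‖ ^ 2 / 2 : ℝ)) + fun _ => (-K - Ir s) from rfl]
      rw [ContDiffAt.laplacian_add hH.contDiffAt contDiff_const.contDiffAt]
      simp [InnerProductSpace.laplacian_const]
    rw [hDw, hΔw]
    have hkey := levelSetModeration_head_subsolution hν.le hcl U hs' y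
    have htd := htend s ⟨hs.1.le, hs.2⟩ y
    show timeDerivWithin (Ico 0 T) p s y + ⟪u s y - U, timeDerivWithin (Ico 0 T) u s y⟫ - r s +
        fderiv ℝ (fun z => p s z + ‖u s z - U‖ ^ 2 / 2) y (u s y) -
        ν * (Δ (fun z => (p s z + ‖u s z - U‖ ^ 2 / 2 : ℝ))) y ≤ 0
    linarith
  have hbdd : ∀ s ∈ Icc 0 t, ∀ y, w s y ≤ B + |K| + R * t := by
    intro s hs y
    show p s y + ‖u s y - U‖ ^ 2 / 2 - K - Ir s ≤ B + |K| + R * t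
    have h1 := (hB s hs y).2
    have h2 := hIr_bd s hs
    have h3 := neg_abs_le (Ir s)
    have h4 := le_abs_self K
    have h5 := neg_abs_le K
    linarith [abs_nonneg K]
  have h0 : ∀ y, w 0 y ≤ 0 := by
    intro y
    show p 0 y + ‖u 0 y - U‖ ^ 2 / 2 - K - Ir 0 ≤ 0
    rw [hIr0]; linarith [hK y]
  have hmain := levelSetModeration_weakMaxPrinciple (w := w) (wt := wt) (a := u) hν.le ht.2 hB0 hcont
    hC2 htime ha hsubsol hbdd h0 τ hτ x
  have : w τ x = p τ x + ‖u τ x - U‖ ^ 2 / 2 - K - Ir τ := rfl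
  linarith

end Head

end Summit.NavierStokesRegularity.NavierStokesRegularity.Theorems
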